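import Mathlib
import HarnessLib.Audit
import Summits.PneNP.PneNP.Theorems.PstarChordReadTight
import Summits.PneNP.PneNP.Theorems.PstarTerminalPeelableTwelve

/-!
# Slack one: three slice-generic chords kill a terminal core with `2·#bdry J₀ ≤ 3·#J₀ + 1` (ROUND-24, O1 beyond exact tightness; memo g22 §19.3)

FRONTIER range-avoidance ladder, rung F-N3, ROUND 24 (cell `pnp-ideate`, prover-2 memos `g21/O1-CHORD-READ-g21.md` §17.3, `g22/O1-PAIRCORE-g22.md`
§19.3; typed target `PstarCoreBoundTargets.TerminalPeelable` (p646951); restricted-model proof complexity — nothing here bears on `P` versus `NP`).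

`PstarChordReadTight` derives the two structural hypotheses of the two-chord theorem (`PstarChordReadTwoChords.false_of_two_gated`) from EXACT
tightness `2·#bdry J₀ ≤ 3·#J₀`.  A thirteen-output core with a centre cycle is no longer tight: it has boundary slack one (`#bdry = 20`).  This file
redoes the boundary bookkeeping with one unit of slack:

* `card_bdry_insert_le_old` — refined insert count: for `S ⊆ varSet g` consisting of variables already read by `X` and `T ⊆ S ∩ bdry X`,
  `#bdry(X + g) + #T + #S ≤ #bdry X + 4` (`PstarChordReadTight.bdry_insert_subset_gen`);
* `exists_inside_partner` — a chord that is NOT outside-gated carries a menu monomial `{v, w}` with `v` one of its privates and `w` read by the core;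
* `card_bdry_insert_le_of_inside` — such a monomial costs: `#bdry(J₀ + g) ≤ #bdry J₀ + 1`, and `≤ #bdry J₀` if `w` is itself a boundary variable;
* **`outsideGated_or_of_slackOne`** — at slack one, of two distinct chords at least one is outside-gated;
* **`no_shared_partner_of_slackOne`** — at slack one, two chords never share a partner (the count of `no_shared_partner_of_tight` verbatim: it
  needs `2·#bdry ≥ 3·#J₀ + 2` to fail);
* **`false_of_slackOne_three_generic`** — a terminal core with `2·#bdry J₀ ≤ 3·#J₀ + 1` has no THREE distinct slice-generic chords;
* **`peelable_of_card_le_thirteen`** — O1 for cores of at most thirteen outputs from (H₁₂) two slice-generic chords on every tight twelve-output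
  centre structure and (H₁₃) three slice-generic chords on every thirteen-output centre structure (these have `#bdry = 20`, at least seven chords).

No Assumption A.
-/

set_option linter.dupNamespace false -- `Summit.PneNP.PneNP.…`: summit = sub-problem name (D-0017 single-conjunct layout)

open Finset Literature.Computability.Complexity
open Summit.PneNP.PneNP.Theorems.PstarTyped (Typed)
open Summit.PneNP.PneNP.Theorems.PstarSALevel (varSet bdry BoundaryExpanding SimpleOverlap)
open Summit.PneNP.PneNP.Theorems.PstarSAClosure (card_varSet_le)
open Summit.PneNP.PneNP.Theorems.PstarGapPeeling (not_mem_varSet_of_private)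
open Summit.PneNP.PneNP.Theorems.PstarCentreFree (vars_mem_varSet)
open Summit.PneNP.PneNP.Theorems.PstarCoreBound (XorClosed)
open Summit.PneNP.PneNP.Theorems.PstarXCore (xverts)
open Summit.PneNP.PneNP.Theorems.PstarChordRepair (IsChord)
open Summit.PneNP.PneNP.Theorems.PstarCoreBoundTargets (Terminal nonchords)
open Summit.PneNP.PneNP.Theorems.PstarSharingBound (sharedSlots card_bdry_add_card_sharedSlots_le)
open Summit.PneNP.PneNP.Theorems.PstarChordBridgeTools (xpdeg)
open Summit.PneNP.PneNP.Theorems.PstarChordBridgeCentre (peelable_nonchords_of_card_lt)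
open Summit.PneNP.PneNP.Theorems.PstarChordBridgeCotree (Peelable)
open Summit.PneNP.PneNP.Theorems.PstarMaxSharingReaders (exists_mem_of_mem_bdry)
open Summit.PneNP.PneNP.Theorems.PstarGateUnit (mem_bdry_of_unique)
open Summit.PneNP.PneNP.Theorems.PstarNorCoreTools (eq_of_mem_bdry)
open Summit.PneNP.PneNP.Theorems.PstarChordReadLemma (SliceGeneric)
open Summit.PneNP.PneNP.Theorems.PstarChordReadSwitches (Touches)
open Summit.PneNP.PneNP.Theorems.PstarChordReadOutside
open Summit.PneNP.PneNP.Theorems.PstarChordReadTwoChords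
open Summit.PneNP.PneNP.Theorems.PstarChordReadTight (bdry_insert_subset_gen card_bdry_insert_le_gen not_mem_and_card)
open Summit.PneNP.PneNP.Theorems.PstarTerminalPeelableTwelve (twelve_le_two_mul_card_sharedSlots exists_centre_of_not_peelable
  peelable_of_card_le_twelve)

namespace Summit.PneNP.PneNP.Theorems.PstarChordReadSlackOne

variable {n m : ℕ}

/-! ## Refined boundary bookkeeping for one inserted output -/
section Bdry

variable (I : LocalMap 4 n m)

/-- **Refined insert count**: if `S ⊆ varSet g` consists of variables already read by members of `X` and `T ⊆ S` of boundary variables of `X`, then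
`#bdry(X + g) + #T + #S ≤ #bdry X + 4`. -/
theorem card_bdry_insert_le_old {X : Finset (Fin m)} {g : Fin m} (hg : g ∉ X) {S T : Finset (Fin n)} (hS : S ⊆ varSet I g)
    (hold : ∀ w ∈ S, ∃ j ∈ X, w ∈ varSet I j) (hTS : T ⊆ S) (hT : T ⊆ bdry I X) :
    (bdry I (insert g X)).card + T.card + S.card ≤ (bdry I X).card + 4 := by
  classical
  have h := card_le_card (bdry_insert_subset_gen I hg)
  have h1 : (bdry I X \ varSet I g).card ≤ (bdry I X).card - T.card := by
    have : bdry I X \ varSet I g ⊆ bdry I X \ T := sdiff_subset_sdiff (Subset.refl _) (hTS.trans hS)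
    refine (card_le_card this).trans ?_
    rw [card_sdiff_of_subset hT]
  have h2 : ((varSet I g).filter fun w => ∀ j ∈ X, w ∉ varSet I j).card ≤ (varSet I g).card - S.card := by
    have : (varSet I g).filter (fun w => ∀ j ∈ X, w ∉ varSet I j) ⊆ varSet I g \ S := by
      intro w hw
      rw [mem_filter] at hw
      refine mem_sdiff.2 ⟨hw.1, fun hwS => ?_⟩
      obtain ⟨j, hj, hwj⟩ := hold w hwS
      exact hw.2 j hj hwj
    refine (card_le_card this).trans ?_
    rw [card_sdiff_of_subset hS]
  have h3 := card_varSet_le I g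
  have h4 : T.card ≤ (bdry I X).card := card_le_card hT
  have h5 : S.card ≤ (varSet I g).card := card_le_card hS
  have h6 := card_union_le (bdry I X \ varSet I g) ((varSet I g).filter fun w => ∀ j ∈ X, w ∉ varSet I j)
  omega

/-- A boundary variable of `X` not read by `g` stays on the boundary of `X + g`. -/
theorem mem_bdry_insert_of_not_mem {X : Finset (Fin m)} {g : Fin m} {v : Fin n} (hv : v ∈ bdry I X) (hvg : v ∉ varSet I g) :
    v ∈ bdry I (insert g X) := by
  obtain ⟨j, hj, hvj⟩ := exists_mem_of_mem_bdry I hv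
  refine mem_bdry_of_unique I (mem_insert_of_mem hj) hvj fun j' hj' hvj' => ?_
  rcases mem_insert.1 hj' with rfl | hj'
  · exact absurd hvj' hvg
  · exact eq_of_mem_bdry I hj' hj hv hvj' hvj

end Bdry

/-! ## Inside partners and their cost -/
section Inside

variable {I : LocalMap 4 n m} {r : ℕ} {y : Fin m → Bool} {J₀ : Finset (Fin m)} {w₁ w₂ : Finset (Fin n) × Finset (Fin m) × Bool}

/-- **A chord that is not outside-gated has an INSIDE PARTNER**: a menu monomial `g` with AND pair `{v, w}`, `v` a private of `c`, and `w` read by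
some output of `J₀`. -/
theorem exists_inside_partner {𝒢 : Finset (Fin m)} {c : Fin m} (h : ¬ OutsideGated I J₀ 𝒢 c) :
    ∃ g ∈ 𝒢, ∃ v w : Fin n, (v = I.vars c 2 ∨ v = I.vars c 3) ∧ ((I.vars g 2 = v ∧ I.vars g 3 = w) ∨ (I.vars g 2 = w ∧ I.vars g 3 = v)) ∧
      ∃ j ∈ J₀, w ∈ varSet I j := by
  classical
  unfold OutsideGated at h
  push Not at h
  obtain ⟨g, hg, htouch, hno⟩ := h
  have key : ∀ v w : Fin n, (v = I.vars c 2 ∨ v = I.vars c 3) → ((I.vars g 2 = v ∧ I.vars g 3 = w) ∨ (I.vars g 2 = w ∧ I.vars g 3 = v)) →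
      ∃ j ∈ J₀, w ∈ varSet I j := by
    intro v w hv hg'
    by_contra hw
    push Not at hw
    exact hno v w ⟨hv, hg', hw⟩
  unfold PstarChordReadSwitches.Touches at htouch
  by_cases h22 : I.vars g 2 = I.vars c 2
  · exact ⟨g, hg, I.vars c 2, I.vars g 3, Or.inl rfl, Or.inl ⟨h22, rfl⟩, key _ _ (Or.inl rfl) (Or.inl ⟨h22, rfl⟩)⟩
  by_cases h32 : I.vars g 3 = I.vars c 2
  · exact ⟨g, hg, I.vars c 2, I.vars g 2, Or.inl rfl, Or.inr ⟨rfl, h32⟩, key _ _ (Or.inl rfl) (Or.inr ⟨rfl, h32⟩)⟩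
  by_cases h23 : I.vars g 2 = I.vars c 3
  · exact ⟨g, hg, I.vars c 3, I.vars g 3, Or.inr rfl, Or.inl ⟨h23, rfl⟩, key _ _ (Or.inr rfl) (Or.inl ⟨h23, rfl⟩)⟩
  by_cases h33 : I.vars g 3 = I.vars c 3
  · exact ⟨g, hg, I.vars c 3, I.vars g 2, Or.inr rfl, Or.inr ⟨rfl, h33⟩, key _ _ (Or.inr rfl) (Or.inr ⟨rfl, h33⟩)⟩
  exact absurd ⟨⟨h22, h32⟩, ⟨h23, h33⟩⟩ htouch

/-- Variables of a monomial in terms of its AND pair description. -/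
theorem mem_varSet_of_pair {g : Fin m} {v w : Fin n} (h : (I.vars g 2 = v ∧ I.vars g 3 = w) ∨ (I.vars g 2 = w ∧ I.vars g 3 = v)) :
    v ∈ varSet I g ∧ w ∈ varSet I g := by
  rcases h with ⟨h2, h3⟩ | ⟨h2, h3⟩
  · exact ⟨h2 ▸ vars_mem_varSet I g 2, h3 ▸ vars_mem_varSet I g 3⟩
  · exact ⟨h3 ▸ vars_mem_varSet I g 3, h2 ▸ vars_mem_varSet I g 2⟩

/-- **Cost of an inside partner**: `#bdry(X + g) ≤ #bdry X + 1` when `g ∉ X` reads a boundary variable `v` of `X` and another variable `w ≠ v`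
already read by `X`; and `#bdry(X + g) ≤ #bdry X` if moreover `w` is a boundary variable of `X`. -/
theorem card_bdry_insert_le_of_inside (hI : I.IsPure xorAndPred) {X : Finset (Fin m)} {g : Fin m} (hg : g ∉ X) {v w : Fin n}
    (hpair : (I.vars g 2 = v ∧ I.vars g 3 = w) ∨ (I.vars g 2 = w ∧ I.vars g 3 = v)) (hv : v ∈ bdry I X) (hw : ∃ j ∈ X, w ∈ varSet I j) :
    (bdry I (insert g X)).card ≤ (bdry I X).card + 1 ∧ (w ∈ bdry I X → (bdry I (insert g X)).card ≤ (bdry I X).card) := by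
  classical
  have hvw : v ≠ w := by
    have h23 : I.vars g 2 ≠ I.vars g 3 := fun e => absurd (hI.2 g e) (by decide)
    rcases hpair with ⟨h2, h3⟩ | ⟨h2, h3⟩
    · exact fun e => h23 (h2.trans (e.trans h3.symm))
    · exact fun e => h23 (h2.trans (e.symm.trans h3.symm))
  obtain ⟨hvg, hwg⟩ := mem_varSet_of_pair hpair
  have hS : ({v, w} : Finset (Fin n)) ⊆ varSet I g := insert_subset_iff.2 ⟨hvg, singleton_subset_iff.2 hwg⟩
  have hold : ∀ u ∈ ({v, w} : Finset (Fin n)), ∃ j ∈ X, u ∈ varSet I j := by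
    intro u hu
    rcases mem_insert.1 hu with rfl | hu
    · exact exists_mem_of_mem_bdry I hv
    · rw [mem_singleton] at hu; subst hu; exact hw
  have hcard : ({v, w} : Finset (Fin n)).card = 2 := card_pair hvw
  constructor
  · have h := card_bdry_insert_le_old I hg hS hold (T := {v}) (singleton_subset_iff.2 (mem_insert_self v _)) (singleton_subset_iff.2 hv)
    rw [card_singleton, hcard] at h
    omega
  · intro hwb
    have h := card_bdry_insert_le_old I hg hS hold (T := {v, w}) (Subset.refl _) (insert_subset_iff.2 ⟨hv, singleton_subset_iff.2 hwb⟩)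
    rw [hcard] at h
    omega

/-- **At slack one, of two distinct chords at least one is outside-gated.** -/
theorem outsideGated_or_of_slackOne (hI : I.IsPure xorAndPred) (hT : Typed I) (hB : BoundaryExpanding r I) (ht : Terminal I r y J₀ w₁ w₂)
    (hslack : 2 * (bdry I J₀).card ≤ 3 * J₀.card + 1) {cᵢ cⱼ : Fin m} (hcᵢ : cᵢ ∈ J₀) (hcⱼ : cⱼ ∈ J₀) (hne : cᵢ ≠ cⱼ) (hchᵢ : IsChord I J₀ cᵢ)
    (hchⱼ : IsChord I J₀ cⱼ) : OutsideGated I J₀ (w₁.2.1 ∪ w₂.2.1) cᵢ ∨ OutsideGated I J₀ (w₁.2.1 ∪ w₂.2.1) cⱼ := by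
  classical
  by_contra hno
  rw [not_or] at hno
  obtain ⟨g, hg, v, w, hv, hpair, hw⟩ := exists_inside_partner hno.1
  obtain ⟨g', hg', v', w', hv', hpair', hw'⟩ := exists_inside_partner hno.2
  obtain ⟨hgJ, -⟩ := not_mem_and_card ht hg
  obtain ⟨hg'J, -⟩ := not_mem_and_card ht hg'
  have hrJ : (J₀ ∪ w₁.2.1 ∪ w₂.2.1).card ≤ r := ht.2.2.2.2.2.1
  have memG : ∀ {g₀}, g₀ ∈ w₁.2.1 ∪ w₂.2.1 → g₀ ∈ J₀ ∪ w₁.2.1 ∪ w₂.2.1 := fun hg₀ => by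
    rcases mem_union.1 hg₀ with h | h
    exacts [mem_union_left _ (mem_union_right _ h), mem_union_right _ h]
  -- the privates
  have hvb : v ∈ bdry I J₀ := by rcases hv with rfl | rfl; exacts [hchᵢ.1, hchᵢ.2]
  have hv'b : v' ∈ bdry I J₀ := by rcases hv' with rfl | rfl; exacts [hchⱼ.1, hchⱼ.2]
  have hvcᵢ : v ∈ varSet I cᵢ := by rcases hv with rfl | rfl; exacts [vars_mem_varSet I cᵢ 2, vars_mem_varSet I cᵢ 3]
  have hv'cⱼ : v' ∈ varSet I cⱼ := by rcases hv' with rfl | rfl; exacts [vars_mem_varSet I cⱼ 2, vars_mem_varSet I cⱼ 3]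
  have hvv' : v ≠ v' := fun e => not_mem_varSet_of_private I hcᵢ hcⱼ hne.symm hvb hvcᵢ (e ▸ hv'cⱼ)
  -- expansion on `J₀ + g`
  have hsub₁ : insert g J₀ ⊆ J₀ ∪ w₁.2.1 ∪ w₂.2.1 := insert_subset_iff.2 ⟨memG hg, fun j hj => mem_union_left _ (mem_union_left _ hj)⟩
  have hexp₁ := hB _ ((card_le_card hsub₁).trans hrJ)
  rw [card_insert_of_notMem hgJ] at hexp₁
  obtain ⟨c₁, c₁'⟩ := card_bdry_insert_le_of_inside hI hgJ hpair hvb hw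
  -- `w` is not a boundary variable (else one gate already breaks expansion); likewise `w'`
  have hwb : w ∉ bdry I J₀ := fun hwb => by have := c₁' hwb; omega
  have hsub₁' : insert g' J₀ ⊆ J₀ ∪ w₁.2.1 ∪ w₂.2.1 := insert_subset_iff.2 ⟨memG hg', fun j hj => mem_union_left _ (mem_union_left _ hj)⟩
  have hexp₁' := hB _ ((card_le_card hsub₁').trans hrJ)
  rw [card_insert_of_notMem hg'J] at hexp₁'
  obtain ⟨-, c₂'⟩ := card_bdry_insert_le_of_inside hI hg'J hpair' hv'b hw'
  have hw'b : w' ∉ bdry I J₀ := fun hw'b => by have := c₂' hw'b; omega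
  -- the two monomials are distinct: `g` would have AND pair `{v, w} ∋ v'`, but `v' ≠ v` and `v'` is a boundary variable
  have hv'g : v' ∉ varSet I g := by
    intro h
    unfold PstarSALevel.varSet at h
    obtain ⟨s, -, hs⟩ := mem_image.1 h
    obtain ⟨t, ht2, htv⟩ : ∃ t : Fin 4, 2 ≤ t.val ∧ I.vars cⱼ t = v' := by
      rcases hv' with e | e
      exacts [⟨2, by decide, e.symm⟩, ⟨3, by decide, e.symm⟩]
    have h4 : ∀ u : Fin 4, u = 0 ∨ u = 1 ∨ u = 2 ∨ u = 3 := by decide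
    rcases h4 s with rfl | rfl | rfl | rfl
    · exact hT g cⱼ 0 t (by decide) ht2 (hs.trans htv.symm)
    · exact hT g cⱼ 1 t (by decide) ht2 (hs.trans htv.symm)
    · rcases hpair with ⟨h2, -⟩ | ⟨h2, -⟩
      · exact hvv' (h2.symm.trans hs)
      · exact hw'b.elim (by rw [h2] at hs; exact absurd (hs ▸ hv'b) hwb)
    · rcases hpair with ⟨-, h3⟩ | ⟨-, h3⟩
      · exact hwb (h3.symm.trans hs ▸ hv'b)
      · exact hvv' (h3.symm.trans hs)
  have hgg : g' ≠ g := fun e => hv'g (e ▸ (mem_varSet_of_pair hpair').1)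
  have hg'X : g' ∉ insert g J₀ := fun h => by
    rcases mem_insert.1 h with e | h
    exacts [hgg e, hg'J h]
  -- second insert: `v'` is still a boundary variable of `J₀ + g`, `w'` is still old
  have hv'b₁ : v' ∈ bdry I (insert g J₀) := mem_bdry_insert_of_not_mem I hv'b hv'g
  have hw'₁ : ∃ j ∈ insert g J₀, w' ∈ varSet I j := by
    obtain ⟨j, hj, hwj⟩ := hw'
    exact ⟨j, mem_insert_of_mem hj, hwj⟩
  obtain ⟨c₂, -⟩ := card_bdry_insert_le_of_inside hI hg'X hpair' hv'b₁ hw'₁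
  -- expansion on `J₀ + g + g'`
  have hsub₂ : insert g' (insert g J₀) ⊆ J₀ ∪ w₁.2.1 ∪ w₂.2.1 := insert_subset_iff.2 ⟨memG hg', hsub₁⟩
  have hexp₂ := hB _ ((card_le_card hsub₂).trans hrJ)
  rw [card_insert_of_notMem hg'X, card_insert_of_notMem hgJ] at hexp₂
  omega

/-- **At slack one two chords never share a partner** (typed instance): the count of `PstarChordReadTight.no_shared_partner_of_tight` verbatim — the
two gates `(v, z)`, `(v', z)` give `#J₀ + 2` outputs with boundary at most `#bdry J₀ + 2`, which needs `2·#bdry J₀ ≥ 3·#J₀ + 2`. -/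
theorem no_shared_partner_of_slackOne (hT : Typed I) (hB : BoundaryExpanding r I) (ht : Terminal I r y J₀ w₁ w₂)
    (hslack : 2 * (bdry I J₀).card ≤ 3 * J₀.card + 1) {cᵢ cⱼ : Fin m} (hcᵢ : cᵢ ∈ J₀) (hcⱼ : cⱼ ∈ J₀) (hne : cᵢ ≠ cⱼ) (hchᵢ : IsChord I J₀ cᵢ)
    (hchⱼ : IsChord I J₀ cⱼ) :
    ∀ z, Partner I J₀ (w₁.2.1 ∪ w₂.2.1) cᵢ z → Partner I J₀ (w₁.2.1 ∪ w₂.2.1) cⱼ z → False := by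
  classical
  rintro z ⟨g, hg, v, hG⟩ ⟨g', hg', v', hG'⟩
  obtain ⟨hgJ, -⟩ := not_mem_and_card ht hg
  obtain ⟨hg'J, -⟩ := not_mem_and_card ht hg'
  -- the privates and the partner
  have memᵢ : v ∈ varSet I cᵢ ∧ v ∈ bdry I J₀ := by
    rcases hG.1 with e | e <;> rw [e]
    exacts [⟨vars_mem_varSet I cᵢ 2, hchᵢ.1⟩, ⟨vars_mem_varSet I cᵢ 3, hchᵢ.2⟩]
  have memⱼ : v' ∈ varSet I cⱼ ∧ v' ∈ bdry I J₀ := by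
    rcases hG'.1 with e | e <;> rw [e]
    exacts [⟨vars_mem_varSet I cⱼ 2, hchⱼ.1⟩, ⟨vars_mem_varSet I cⱼ 3, hchⱼ.2⟩]
  have hvv : v ≠ v' := fun e => not_mem_varSet_of_private I hcᵢ hcⱼ hne.symm memᵢ.2 memᵢ.1 (e ▸ memⱼ.1)
  have hvz : v ≠ z := hG.ne hcᵢ
  have hv'z : v' ≠ z := hG'.ne hcⱼ
  have hvg : v ∈ varSet I g := by
    rcases hG.2.1 with ⟨h2, -⟩ | ⟨-, h3⟩
    exacts [h2 ▸ vars_mem_varSet I g 2, h3 ▸ vars_mem_varSet I g 3]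
  have hzg : z ∈ varSet I g := by
    rcases hG.2.1 with ⟨-, h3⟩ | ⟨h2, -⟩
    exacts [h3 ▸ vars_mem_varSet I g 3, h2 ▸ vars_mem_varSet I g 2]
  have hv'g' : v' ∈ varSet I g' := by
    rcases hG'.2.1 with ⟨h2, -⟩ | ⟨-, h3⟩
    exacts [h2 ▸ vars_mem_varSet I g' 2, h3 ▸ vars_mem_varSet I g' 3]
  have hzg' : z ∈ varSet I g' := by
    rcases hG'.2.1 with ⟨-, h3⟩ | ⟨h2, -⟩
    exacts [h3 ▸ vars_mem_varSet I g' 3, h2 ▸ vars_mem_varSet I g' 2]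
  -- `v'` is not a variable of `g` (typed: not an XOR variable; not `v`, not `z`)
  have hv'g : v' ∉ varSet I g := by
    intro h
    unfold PstarSALevel.varSet at h
    obtain ⟨s, -, hs⟩ := mem_image.1 h
    obtain ⟨t, ht2, htv⟩ : ∃ t : Fin 4, 2 ≤ t.val ∧ I.vars cⱼ t = v' := by
      rcases hG'.1 with e | e
      exacts [⟨2, by decide, e.symm⟩, ⟨3, by decide, e.symm⟩]
    have h4 : ∀ u : Fin 4, u = 0 ∨ u = 1 ∨ u = 2 ∨ u = 3 := by decide
    rcases h4 s with rfl | rfl | rfl | rfl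
    · exact hT g cⱼ 0 t (by decide) ht2 (hs.trans htv.symm)
    · exact hT g cⱼ 1 t (by decide) ht2 (hs.trans htv.symm)
    · rcases hG.2.1 with ⟨h2, -⟩ | ⟨h2, -⟩
      · exact hvv (h2.symm.trans hs)
      · exact hv'z (hs.symm.trans h2)
    · rcases hG.2.1 with ⟨-, h3⟩ | ⟨-, h3⟩
      · exact hv'z (hs.symm.trans h3)
      · exact hvv (h3.symm.trans hs)
  -- the two gates are distinct
  have hgg : g' ≠ g := fun e => hv'g (e ▸ hv'g')
  have hg'X : g' ∉ insert g J₀ := fun h => by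
    rcases mem_insert.1 h with e | h
    exacts [hgg e, hg'J h]
  -- boundary counts
  have c₁ := card_bdry_insert_le_gen I hgJ (T := {v}) (singleton_subset_iff.2 hvg) (singleton_subset_iff.2 memᵢ.2)
  have hv'b : v' ∈ bdry I (insert g J₀) :=
    mem_bdry_of_unique I (mem_insert_of_mem hcⱼ) memⱼ.1 fun j' hj' hv'j' => by
      rcases mem_insert.1 hj' with rfl | hj'
      · exact absurd hv'j' hv'g
      · exact eq_of_mem_bdry I hj' hcⱼ memⱼ.2 hv'j' memⱼ.1
  have hzb : z ∈ bdry I (insert g J₀) :=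
    mem_bdry_of_unique I (mem_insert_self g J₀) hzg fun j' hj' hzj' => by
      rcases mem_insert.1 hj' with rfl | hj'
      · rfl
      · exact absurd hzj' (hG.2.2 j' hj')
  have c₂ := card_bdry_insert_le_gen I hg'X (T := {v', z})
    (insert_subset_iff.2 ⟨hv'g', singleton_subset_iff.2 hzg'⟩) (insert_subset_iff.2 ⟨hv'b, singleton_subset_iff.2 hzb⟩)
  rw [card_singleton] at c₁
  rw [card_pair hv'z] at c₂
  -- expansion on the `#J₀ + 2` outputs
  have hsub : insert g' (insert g J₀) ⊆ J₀ ∪ w₁.2.1 ∪ w₂.2.1 := by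
    intro j hj
    rcases mem_insert.1 hj with rfl | hj
    · rcases mem_union.1 hg' with h | h
      exacts [mem_union_left _ (mem_union_right _ h), mem_union_right _ h]
    rcases mem_insert.1 hj with rfl | hj
    · rcases mem_union.1 hg with h | h
      exacts [mem_union_left _ (mem_union_right _ h), mem_union_right _ h]
    · exact mem_union_left _ (mem_union_left _ hj)
  have hexp := hB _ ((card_le_card hsub).trans ht.2.2.2.2.2.1)
  rw [card_insert_of_notMem hg'X, card_insert_of_notMem hgJ] at hexp
  omega


/-- **A terminal core with boundary slack at most one has no THREE distinct slice-generic chords.** -/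
theorem false_of_slackOne_three_generic (hI : I.IsPure xorAndPred) (hT : Typed I) (hS : SimpleOverlap I) (hB : BoundaryExpanding r I)
    (ht : Terminal I r y J₀ w₁ w₂) (hslack : 2 * (bdry I J₀).card ≤ 3 * J₀.card + 1) {c₁ c₂ c₃ : Fin m} (hc₁ : c₁ ∈ J₀) (hc₂ : c₂ ∈ J₀)
    (hc₃ : c₃ ∈ J₀) (h₁₂ : c₁ ≠ c₂) (h₁₃ : c₁ ≠ c₃) (h₂₃ : c₂ ≠ c₃) (hch₁ : IsChord I J₀ c₁) (hch₂ : IsChord I J₀ c₂) (hch₃ : IsChord I J₀ c₃)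
    (hgen₁ : SliceGeneric I y J₀ c₁ (w₁.2.1 ∪ w₂.2.1)) (hgen₂ : SliceGeneric I y J₀ c₂ (w₁.2.1 ∪ w₂.2.1))
    (hgen₃ : SliceGeneric I y J₀ c₃ (w₁.2.1 ∪ w₂.2.1)) : False := by
  have kill : ∀ {cᵢ cⱼ : Fin m}, cᵢ ∈ J₀ → cⱼ ∈ J₀ → cᵢ ≠ cⱼ → IsChord I J₀ cᵢ → IsChord I J₀ cⱼ →
      OutsideGated I J₀ (w₁.2.1 ∪ w₂.2.1) cᵢ → OutsideGated I J₀ (w₁.2.1 ∪ w₂.2.1) cⱼ →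
      SliceGeneric I y J₀ cᵢ (w₁.2.1 ∪ w₂.2.1) → SliceGeneric I y J₀ cⱼ (w₁.2.1 ∪ w₂.2.1) → False :=
    fun hcᵢ hcⱼ hne hchᵢ hchⱼ hOᵢ hOⱼ hgᵢ hgⱼ =>
      false_of_two_gated hI hT hS hB ht hcᵢ hcⱼ hne hchᵢ hchⱼ hOᵢ hOⱼ (no_shared_partner_of_slackOne hT hB ht hslack hcᵢ hcⱼ hne hchᵢ hchⱼ) hgᵢ hgⱼ
  rcases outsideGated_or_of_slackOne hI hT hB ht hslack hc₁ hc₂ h₁₂ hch₁ hch₂ with hO₁ | hO₂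
  · rcases outsideGated_or_of_slackOne hI hT hB ht hslack hc₂ hc₃ h₂₃ hch₂ hch₃ with hO₂ | hO₃
    · exact kill hc₁ hc₂ h₁₂ hch₁ hch₂ hO₁ hO₂ hgen₁ hgen₂
    · exact kill hc₁ hc₃ h₁₃ hch₁ hch₃ hO₁ hO₃ hgen₁ hgen₃
  · rcases outsideGated_or_of_slackOne hI hT hB ht hslack hc₁ hc₃ h₁₃ hch₁ hch₃ with hO₁ | hO₃
    · exact kill hc₁ hc₂ h₁₂ hch₁ hch₂ hO₁ hO₂ hgen₁ hgen₂
    · exact kill hc₂ hc₃ h₂₃ hch₂ hch₃ hO₂ hO₃ hgen₂ hgen₃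

end Inside

/-! ## O1 up to thirteen outputs -/
section Thirteen

variable {I : LocalMap 4 n m} {r : ℕ}

/-- **A thirteen-output XOR-closed family with a centre cycle has boundary slack at most one** (`#bdry ≤ 20`). -/
theorem slackOne_of_centre_thirteen (I : LocalMap 4 n m) (hI : I.IsPure xorAndPred) (hT : Typed I) (hS : SimpleOverlap I)
    (hB : BoundaryExpanding r I) {J₀ : Finset (Fin m)} (hX : XorClosed I J₀) (hr : J₀.card ≤ r) (hk : J₀.card = 13) {S : Finset (Fin m)}
    (hSJ : S ⊆ J₀) (hne : S.Nonempty) (hL : ∀ w ∈ xverts I S, 2 ≤ xpdeg I S w) (hnc : ∀ f ∈ S, ¬ IsChord I J₀ f) :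
    2 * (bdry I J₀).card ≤ 3 * J₀.card + 1 := by
  have h₁ := twelve_le_two_mul_card_sharedSlots I hI hT hS hB hr hSJ hne hL hnc
  have h₂ := card_bdry_add_card_sharedSlots_le I J₀ hX
  omega

/-- **O1 FOR CORES OF AT MOST THIRTEEN OUTPUTS** from (H₁₂) two distinct slice-generic chords on every twelve-output max-sharing terminal core with a
centre cycle and (H₁₃) three distinct slice-generic chords on every thirteen-output terminal core with a centre cycle and `#bdry ≤ 20`. -/
theorem peelable_of_card_le_thirteen (hI : I.IsPure xorAndPred) (hT : Typed I) (hS : SimpleOverlap I) (hB : BoundaryExpanding r I)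
    (h₁₂ : ∀ (y : Fin m → Bool) (J₀ : Finset (Fin m)) (w₁ w₂ : Finset (Fin n) × Finset (Fin m) × Bool), Terminal I r y J₀ w₁ w₂ →
      J₀.card = 12 → 2 * (sharedSlots I J₀).card = J₀.card →
      (∃ S ⊆ J₀, S.Nonempty ∧ (∀ w ∈ xverts I S, 2 ≤ xpdeg I S w) ∧ ∀ f ∈ S, ¬ IsChord I J₀ f) →
      ∃ cᵢ ∈ J₀, ∃ cⱼ ∈ J₀, cᵢ ≠ cⱼ ∧ IsChord I J₀ cᵢ ∧ IsChord I J₀ cⱼ ∧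
        SliceGeneric I y J₀ cᵢ (w₁.2.1 ∪ w₂.2.1) ∧ SliceGeneric I y J₀ cⱼ (w₁.2.1 ∪ w₂.2.1))
    (h₁₃ : ∀ (y : Fin m → Bool) (J₀ : Finset (Fin m)) (w₁ w₂ : Finset (Fin n) × Finset (Fin m) × Bool), Terminal I r y J₀ w₁ w₂ →
      J₀.card = 13 → 2 * (bdry I J₀).card ≤ 3 * J₀.card + 1 →
      (∃ S ⊆ J₀, S.Nonempty ∧ (∀ w ∈ xverts I S, 2 ≤ xpdeg I S w) ∧ ∀ f ∈ S, ¬ IsChord I J₀ f) →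
      ∃ c₁ ∈ J₀, ∃ c₂ ∈ J₀, ∃ c₃ ∈ J₀, c₁ ≠ c₂ ∧ c₁ ≠ c₃ ∧ c₂ ≠ c₃ ∧ IsChord I J₀ c₁ ∧ IsChord I J₀ c₂ ∧ IsChord I J₀ c₃ ∧
        SliceGeneric I y J₀ c₁ (w₁.2.1 ∪ w₂.2.1) ∧ SliceGeneric I y J₀ c₂ (w₁.2.1 ∪ w₂.2.1) ∧ SliceGeneric I y J₀ c₃ (w₁.2.1 ∪ w₂.2.1))
    {y : Fin m → Bool} {J₀ : Finset (Fin m)} {w₁ w₂ : Finset (Fin n) × Finset (Fin m) × Bool} (ht : Terminal I r y J₀ w₁ w₂)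
    (hk : J₀.card ≤ 13) : Peelable I (nonchords I J₀) := by
  rcases Nat.lt_or_ge J₀.card 13 with hlt | hge
  · exact peelable_of_card_le_twelve hI hT hS hB h₁₂ ht (by omega)
  · have hk13 : J₀.card = 13 := le_antisymm hk hge
    have hX : XorClosed I J₀ := ht.2.1
    have hr : J₀.card ≤ r := ht.2.2.1.le
    by_contra hnp
    obtain ⟨S, hSJ, hne, hL, hnc⟩ := exists_centre_of_not_peelable I hnp
    have hslack := slackOne_of_centre_thirteen I hI hT hS hB hX hr hk13 hSJ hne hL hnc
    obtain ⟨c₁, hc₁, c₂, hc₂, c₃, hc₃, h₁₂', h₁₃', h₂₃, hch₁, hch₂, hch₃, hg₁, hg₂, hg₃⟩ :=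
      h₁₃ y J₀ w₁ w₂ ht hk13 hslack ⟨S, hSJ, hne, hL, hnc⟩
    exact false_of_slackOne_three_generic hI hT hS hB ht hslack hc₁ hc₂ hc₃ h₁₂' h₁₃' h₂₃ hch₁ hch₂ hch₃ hg₁ hg₂ hg₃

end Thirteen

end Summit.PneNP.PneNP.Theorems.PstarChordReadSlackOne
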